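import Summits.PneNP.PneNP.Theorems.MatroidTseitinExpandingXorDepthFregeLBColumnTwo

/-!
# PneNP / MatroidTseitin — `ExpandingXorDepthFregeLB` is equivalent to its column-weight-`≥ 3`
case

Route `PneNP/MatroidTseitin`, crux stmt-PneNP-11426
(`Summit.PneNP.PneNP.Theses.MatroidTseitin.ExpandingXorDepthFregeLB`, Ben-Sasson–Wigderson for
bounded-depth Frege). The column-weight-`≤ 2` slice of the crux is a theorem of the tree
(`ColumnTwo.expandingXorDepthFregeLB_of_colWeight_le_two`, unconditional, every rate `c` and scale
`δn`). Hence the crux is EQUIVALENT to its restriction to systems in which some variable occurs in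
at least three equations — the hypergraph case (random `k`-XOR, `2k`-uniform hypergraph Tseitin for
`k ≥ 2`, sparse linear generators), open in print. This file records that equivalence, so that the
open core of the item is a single displayed statement.

* `expandingXorDepthFregeLB_iff_three_le_colWeight` — the equivalence.

References: J. Krajíček, *Proof complexity* (CUP 2019), Problem 19.4.5; N. Galesi, D. Itsykson,
A. Riazanov, A. Sofronova, APAL 174 (2023) (the graph case, via treewidth).
-/

namespace Summit.PneNP.PneNP.Theorems

set_option linter.dupNamespace false -- `Summit.PneNP.PneNP.…`: summit = sub-problem (D-0017)

open Literature.Computability.MetaComplexity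
open Literature.Computability.Complexity (PropForm)

/-- **The crux is its column-weight-`≥ 3` case.** `ExpandingXorDepthFregeLB` holds iff it holds
for the systems `E` in which some variable lies in the support of at least three equations:
the column-weight-`≤ 2` systems are covered by
`ColumnTwo.expandingXorDepthFregeLB_of_colWeight_le_two` (take `ε = min ε₁ ε₂`, `N = max N₁ N₂ 1`).
[Krajíček 2019, Problem 19.4.5 (structural form); Galesi–Itsykson–Riazanov–Sofronova 2023
(the graph case)] -/
theorem expandingXorDepthFregeLB_iff_three_le_colWeight :
    Summit.PneNP.PneNP.Theses.MatroidTseitin.ExpandingXorDepthFregeLB ↔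
    ∀ (ℓ d : ℕ) (δ c : ℝ), 0 < δ → 0 < c → ∃ ε : ℝ, 0 < ε ∧ ∃ N : ℕ, ∀ n ≥ N,
      ∀ (m : ℕ) (E : Fin m → LinEqMod 2 n),
      (∃ j : Fin n, 3 ≤ (Finset.univ.filter fun i => j ∈ (E i).supp).card) →
      (∀ e, (E e).supp.card ≤ ℓ) →
      IsBoundaryExpander (fun e : Fin m => ((E e).supp).map Fin.valEmbedding) (δ * n) c →
      ¬ SystemSat E Finset.univ →
      ∀ π : List (PropForm ℕ),
        textbookFrege.IsDepthProofOf d π (PropForm.neg (PropForm.ofCNF (sumEncoding 1 E))) →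
          (2 : ℝ) ^ ((n : ℝ) ^ ε) ≤ (proofSize π : ℝ) := by
  unfold Summit.PneNP.PneNP.Theses.MatroidTseitin.ExpandingXorDepthFregeLB
  constructor
  · intro h ℓ d δ c hδ hc
    obtain ⟨ε, hε, N, hN⟩ := h ℓ d δ c hδ hc
    exact ⟨ε, hε, N, fun n hn m E _ hsparse hexp hunsat π hπ => hN n hn m E hsparse hexp hunsat π hπ⟩
  · intro h ℓ d δ c hδ hc
    obtain ⟨ε₁, hε₁, N₁, hN₁⟩ := ColumnTwo.expandingXorDepthFregeLB_of_colWeight_le_two ℓ d δ c hδ hc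
    obtain ⟨ε₂, hε₂, N₂, hN₂⟩ := h ℓ d δ c hδ hc
    refine ⟨min ε₁ ε₂, lt_min hε₁ hε₂, max (max N₁ N₂) 1, ?_⟩
    intro n hn m E hsparse hexp hunsat π hπ
    have hn1 : (1 : ℝ) ≤ n := by exact_mod_cast le_trans (le_max_right _ _) hn
    have hmono : ∀ {ε : ℝ}, min ε₁ ε₂ ≤ ε →
        (2 : ℝ) ^ ((n : ℝ) ^ min ε₁ ε₂) ≤ (2 : ℝ) ^ ((n : ℝ) ^ ε) := fun hle =>
      Real.rpow_le_rpow_of_exponent_le one_le_two (Real.rpow_le_rpow_of_exponent_le hn1 hle)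
    by_cases hcol : ∀ j : Fin n, (Finset.univ.filter fun i => j ∈ (E i).supp).card ≤ 2
    · exact (hmono (min_le_left _ _)).trans
        (hN₁ n (le_trans (le_trans (le_max_left _ _) (le_max_left _ _)) hn) m E hcol hsparse hexp
          hunsat π hπ)
    · push Not at hcol
      obtain ⟨j, hj⟩ := hcol
      exact (hmono (min_le_right _ _)).trans
        (hN₂ n (le_trans (le_trans (le_max_right _ _) (le_max_left _ _)) hn) m E ⟨j, hj⟩ hsparse
          hexp hunsat π hπ)

end Summit.PneNP.PneNP.Theorems
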